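import Summits.ResolutionOfSingularities.ResolutionOfSingularities.Theorems.PurelyInseparableDim4SwapTransportWindowIterSigma
import Summits.ResolutionOfSingularities.ResolutionOfSingularities.Theorems.PurelyInseparableDim4ResConeTwoSlotWindowSigma
import HarnessLib
import HarnessLib.Audit.Tags

/-!
# Purely inseparable four-folds — THE VIRTUAL WINDOW IS PLAYED FOR EVERY σ = (n, n) + 0: res-dim4-p-7 g6's finite two-slot game
# `ResCone.no_twoSlot_pureCorner_window_sigma` on the `T + 1` pure virtual slot steps of I1 (cell `res-dim4-pi`, K2(p) lane, B-LF (iii-b)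
# class (iii), virtual port 1 ↦ n of the C∞ window, FILE B1 = W5b `…SwapTransportWindowPlayPrime` p717317 with `1 ↦ n`)

[OURS · counted 0 · cell `res-dim4-pi` · K2(p) lane (holder res-dim4-p-12 g5, rulings g5-21 (α) / g5-23) · seat res-dim4-typ-1 g6; the game half
is res-dim4-p-7 g6's `…ResConeTwoSlotWindowSigma` p723139 (finite-window edition of δ2, `T ≥ 4(d − 1) + 2`, `w = 0` allowed) over res-dim4-p-3's
window form of res-dim4-p-9's C∞ game.]  Nothing here proves K2(p) for any `p`, any TAIL(p, d, 3), `NoIsolatedTrap p p` or resolution of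
singularities in dimension ≥ 4 / characteristic `p` — NOT proved.  AI kernel work, weaker than expert review.  This file closes nothing by itself:
it reduces a class-(iii) two-slot tail σ = (n, n) + 0 to the ENTRY (a framed virtual partner at ONE real time with dead ROW `(eu, ef)` and FLAG)
plus a virtual letter change.  HONEST STATUS OF THE ENTRY'S FLAG (ruling g5-23): the row flag AS WORDED is refuted on real chains (res-dim4-eng-w4
QFLAG-1, 778 / 3,790 flagless in-regime nodes); this file carries the flag only as TRANSPORTED frame data (I1), exactly as S1/I1 do — the reshape
(FLAGLESS-1 / FLAGLESS♯ / QFLAG-2) concerns the ENTRY side, not this composition.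

**`virtual_window_false_of_entry_sigma0`** — given an ENTRY at real time `k` (relation along `π₀`, real weights `n·π₀λ + n·π₀μ`, virtual frame:
order `p + n`, `r = n·λ + n·μ`, `x^r ∣ F`, `resForm = a·x_f^d`, slot ledger, dead row below `N`, flag, isolated, `e_G = 3`), a common isolation
certificate level `Nc` of `c k, …, c (k+T+1)`, the real regime up to `k + T + 1`, the virtual data `(πs, Bs, ℓs)` generated by the recursion
rule, `T ≥ 4(d − 1) + 2`, budgets `Nc + 2p + n + 1 + p(T+1) ≤ M`, `p + n + 2 + d(T+1) ≤ N`, and a virtual letter change at the start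
(`ℓs 0 = λ`, `ℓs 1 = μ`): `False` — I1 `virtual_iterate_sigma0` for `T + 1` steps, the two residual readings at `Bs 0` by T1's
`readings_of_resForm_sigma`, the Tschirnhaus row by F1's `tsch_row_of_ledger_sigma0`, then res-dim4-p-7's `ResCone.no_twoSlot_pureCorner_window_sigma`
on `Bs` with `w = 0` and the chart word `x t = decide (ℓs t = λ)`.
[cite: Hauser2010, §§F–G] [cite: CossartJannsenSaito2020, Thm. 3.14]
bears_on: LADDER-RESOLUTION:D157-DOOR2 (res-dim4-pi · K2(p) · power cones · class (iii) virtual window played ∀ p ∀ n).  Supports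
stmt-ResolutionOfSingularities-16155 (helper).
-/

set_option linter.dupNamespace false -- mandated namespace of this single-conjunct summit

noncomputable section

namespace Summit.ResolutionOfSingularities.ResolutionOfSingularities.Theorems.PIDim4

namespace SwapTransport

open MvPolynomial Finset
open Literature.AlgebraicGeometry.Resolution
open Literature.AlgebraicGeometry.Resolution.CentreBlowup
open Literature.AlgebraicGeometry.Resolution.Hauser2010
open Literature.AlgebraicGeometry.Resolution.HauserPerlega2019

variable {K : Type} [Field K] [DecidableEq K]

/-! ## The window from an entry, every prime, every σ = (n, n) + 0 -/

/-- **THE VIRTUAL WINDOW IS PLAYED, every prime, every σ = (n, n) + 0** (module docstring): from an entry at real time `k`, `T + 1` shadowed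
steps (`virtual_iterate_sigma0`), `T ≥ 4(d − 1) + 2`, and res-dim4-p-7 g6's `ResCone.no_twoSlot_pureCorner_window_sigma` (with `w = 0`) on
the shadow. [OURS] [cite: Hauser2010, §§F–G] [cite: CossartJannsenSaito2020, Thm. 3.14] -/
theorem virtual_window_false_of_entry_sigma0 (p : ℕ) [Fact p.Prime] [CharP K p] {n d : ℕ} (hσ : n + d = p) (hn : 0 < n) (hd2 : 2 ≤ d)
    {eu ef : ℕ} (hef : eu + ef = d - 2) {la mu u f : Fin 4} (hlm : la ≠ mu) (hlu : la ≠ u) (hlf : la ≠ f) (hmu : mu ≠ u) (hmf : mu ≠ f)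
    (huf : u ≠ f) {c : ℕ → State K} {j : ℕ → Fin 4} {b : ℕ → Fin 4 → K} (hw : FreeTail.IsWitnessedChain p c j b) {k Nc T : ℕ}
    (hT : 4 * (d - 1) + 2 ≤ T) (hisoR : ∀ t, t ≤ T + 1 → IsIsolated p (c (k + t)).F)
    (hcert : ∀ t, t ≤ T + 1 → originIdeal K ^ Nc ≤ singLocusIdeal p (c (k + t)).F ⊔ originIdeal K ^ (Nc + 1))
    (hoR : ∀ t, t ≤ T + 1 → ordZero (c (k + t)).F = ((p + n : ℕ) : ℕ∞))
    (he3R : ∀ t, t ≤ T + 1 → Module.finrank K (ResCone.resVertex (c (k + t))) = 3)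
    (hwtR : ∀ t, t ≤ T + 1 → (c (k + t)).r.degree = 2 * n)
    (hdivR : ∀ t, t ≤ T + 1 → ∀ e ∈ (c (k + t)).F.support, (c (k + t)).r ≤ e)
    {πs : ℕ → Equiv.Perm (Fin 4)} {Bs : ℕ → State K} {ℓs : ℕ → Fin 4}
    (hBs : ∀ t, Bs (t + 1) = CentreBlowup.step p Finset.univ (ℓs t) 0 (Bs t))
    (hℓs : ∀ t, ℓs t = if j (k + t) = πs t la then la else if j (k + t) = πs t mu then mu
      else if b (k + t) (πs t la) ≠ 0 then la else mu)
    (hπs : ∀ t, πs (t + 1) = if j (k + t) = πs t la ∨ j (k + t) = πs t mu then πs t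
      else (Equiv.swap (ℓs t) ((πs t).symm (j (k + t)))).trans (πs t))
    {M N : ℕ} (hM : Nc + 2 * p + n + 1 + p * (T + 1) ≤ M) (hN : p + n + 2 + d * (T + 1) ≤ N)
    (hrel0 : ∃ (θ e : Fin 4 → MvPolynomial (Fin 4) K) (U E : MvPolynomial (Fin 4) K),
      θ (πs 0 la) = X la * e la ∧ θ (πs 0 mu) = X mu * e mu ∧ constantCoeff (e la) ≠ 0 ∧ constantCoeff (e mu) ≠ 0 ∧
      constantCoeff (θ (πs 0 u)) = 0 ∧ constantCoeff (θ (πs 0 f)) = 0 ∧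
      coeff (Finsupp.single u 1) (θ (πs 0 u)) * coeff (Finsupp.single f 1) (θ (πs 0 f)) -
        coeff (Finsupp.single f 1) (θ (πs 0 u)) * coeff (Finsupp.single u 1) (θ (πs 0 f)) ≠ 0 ∧
      constantCoeff U ≠ 0 ∧ E ∈ originIdeal K ^ M ∧ (Bs 0).F = deletePthPowers p (U ^ p * aeval θ (c k).F) + E)
    (hrA0 : (c k).r = Finsupp.single (πs 0 la) n + Finsupp.single (πs 0 mu) n)
    (hfr0 : ordZero (Bs 0).F = ((p + n : ℕ) : ℕ∞) ∧ (Bs 0).r = Finsupp.single la n + Finsupp.single mu n ∧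
      (∀ e ∈ (Bs 0).F.support, (Bs 0).r ≤ e) ∧ (∃ a : K, a ≠ 0 ∧ ResCone.resForm (Bs 0) = C a * X f ^ d) ∧
      (∀ e ∈ (Bs 0).F.support, e f ≤ d - 1 → n + 1 ≤ e la ∧ n + 1 ≤ e mu) ∧
      (∀ e ∈ (Bs 0).F.support, e.degree < N → ¬ (e u = eu ∧ e f = ef)) ∧
      coeff ((Bs 0).r + (Finsupp.single la 1 + Finsupp.single mu 1 + Finsupp.single u (eu + 1) + Finsupp.single f ef)) (Bs 0).F ≠ 0 ∧
      IsIsolated p (Bs 0).F ∧ Module.finrank K (ResCone.resVertex (Bs 0)) = 3)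
    (hx0 : ℓs 0 = la) (hx1 : ℓs 1 = mu) : False := by
  have hP := virtual_iterate_sigma0 p hσ hn hd2 hef hlm hlu hlf hmu hmf huf hw hisoR hcert hoR he3R hwtR hdivR hBs hℓs hπs
    (T := T + 1) hM hN hrel0 hrA0 hfr0
  have hslot : ∀ t, ℓs t = la ∨ ℓs t = mu := fun t => by
    rw [hℓs t]
    split_ifs
    exacts [Or.inl rfl, Or.inr rfl, Or.inl rfl, Or.inr rfl]
  -- the chart word of the virtual play as a Boolean sequence (`true` = slot `λ`, `false` = slot `μ`)
  set x : ℕ → Bool := fun t => decide (ℓs t = la) with hx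
  have hxs : ∀ t, (if x t then la else mu) = ℓs t := fun t => by
    rcases hslot t with h | h
    · simp [hx, h]
    · simp [hx, h, hlm.symm]
  have hstep : ∀ t, t ≤ T → (∃ a : K, a ≠ 0 ∧ ResCone.resForm (Bs t) = C a * X f ^ d) →
      Bs (t + 1) = CentreBlowup.step p Finset.univ (if x t then la else mu) 0 (Bs t) := fun t _ _ => by
    rw [hxs t]; exact hBs t
  have hx0' : x 0 = true := by simp [hx, hx0]
  have hx1' : x 1 = false := by simp [hx, hx1, hlm.symm]
  -- the two residual readings and the Tschirnhaus row of the first virtual state, from its frame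
  obtain ⟨a, ha, hform0⟩ := hfr0.2.2.2.1
  have hrdeg0 : (Bs 0).r.degree + d = p + n := by
    rw [hfr0.2.1, map_add, Finsupp.degree_single, Finsupp.degree_single]; omega
  obtain ⟨ha0, hstraight0⟩ := readings_of_resForm_sigma hfr0.1 hrdeg0 hform0
  have hBmu : (Bs 0).r mu = n := by
    rw [hfr0.2.1, Finsupp.add_apply, Finsupp.single_eq_of_ne hlm.symm, Finsupp.single_eq_same, zero_add]
  have hBf : (Bs 0).r f = 0 := by
    rw [hfr0.2.1, Finsupp.add_apply, Finsupp.single_eq_of_ne hlf.symm, Finsupp.single_eq_of_ne hmf.symm, add_zero]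
  have htsch0 := tsch_row_of_ledger_sigma0 (d := d) hlm hlf hmf hBmu hBf hfr0.2.2.2.2.1
  have hr0 : (Bs 0).r = Finsupp.single la n + Finsupp.single mu n + Finsupp.single u 0 := by
    rw [hfr0.2.1, Finsupp.single_zero, add_zero]
  exact ResCone.no_twoSlot_pureCorner_window_sigma hlm hlu hlf hmu hmf huf p (n := n) (w := 0) (d := d) (by omega) hn hd2 hT Bs x
    hstep hr0 hfr0.2.2.1 (fun t ht => (hP t ht).2.2.1) (fun t ht => (hP t ht).2.2.2.2.2.2.2.2.2.2)
    (fun t ht => (hP t ht).2.2.2.2.2.2.2.2.2.1) (by rw [ha0]; exact ha) hstraight0 htsch0 hfr0.2.2.2.2.1 hx0' hx1'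

end SwapTransport

end Summit.ResolutionOfSingularities.ResolutionOfSingularities.Theorems.PIDim4

end
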